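import Summits.QuantumFields.YangMills.Theorems.BalabanUVNodesN19TVProductBlocks
import Summits.QuantumFields.YangMills.Theorems.BalabanUVNodesN19TVTiltSharpLeaf
import Summits.QuantumFields.YangMills.Theorems.BalabanUVNodesN19CoreProductBlocks

/-!
# BalabanUVNodes ∕ N19 — MASS_cl ∧ TV_cl (∧ SHAPE_cl) OVER INDEPENDENT BLOCKS, CLASS LEVEL: blockwise two-run matching data carry EVERY bounded JOINT
# observable on the product class space (`Core` with ONE constant, N14's `TiltedMeanMatching` at the sharp rate); the product TV radius is SHARP

Cell `pub-ymgap` (HUMAN RULING D-0062 Track A ∕ D-0149 width seats), WIDTH SEAT `pub-ymgap-dag-n19-w2` (node n19 = NE7, seat 2 of 3), generation g4,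
CLAIM-1 ∕ INTENT-2 (INBOX l.28752).  Route `Summits/QuantumFields/YangMills/Theses/BalabanUVNodes.lean`, key item K3⁷ `SpineGivenEndpointR13SepCoPH`
(stmt-QuantumFields-20544); filed `--kind proof --supports … --as helper`.  COUNT-NEUTRAL.  THEOREMS ONLY (0 `def`, 0 `sorry`); imports this seat's g4 file 1
`…N19TVProductBlocks` (one-class product currencies), g3 `…N19TVTiltSharpLeaf` (sharp TV ⇒ tilted-mean rate; through it n19-c's `…N19CoreTVInvariant`:
`core_of_mass_of_tv`, `tvSandwich_of_shapeSandwich`) and g2 `…N19CoreProductBlocks` (`mem_good_prod_iff`, the block bad-class convention); edits nothing, re-declares nothing.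

SETTING (two INDEPENDENT BLOCKS at the class level).  Block `b ∈ {1, 2}` has its own history index `ι_b`, admissible classes `T_b K`, bad classes `Bad_b K t`, class
spaces `Ω_b K` and the two runs' class pieces `μA_b K τ_b`, `μB_b K τ_b` (finite measures).  The product datum: index `ι₁ × ι₂`, classes `T₁ K ×ˢ T₂ K`, bad class
`Bad₁ K t ×ˢ T₂ K ∪ T₁ K ×ˢ Bad₂ K t` («bad iff some block is bad», g2's `core_prod` convention), class space `Ω₁ K × Ω₂ K`, class pieces
`μA₁ K τ.1 ⊗ μA₂ K τ.2`, `μB₁ K τ.1 ⊗ μB₂ K τ.2`.  A JOINT observable is any bounded measurable `W_K : Ω₁ K × Ω₂ K → ℝ` — e.g. a loop functional reading two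
independently matched slot families — NOT necessarily a product ∕ sum of block observables (those are what g2's term-level `core_prod` reaches).

WHAT IS PROVED ([folklore] measure theory ∕ bookkeeping over the tree's shapes).
* §1 ★★ SHARPNESS of file 1's product radius: `twoPoint_toy` · `tv_prod_sharp_toy` — on `Bool × Bool`, `p = q = δ_false`, `p′ = (1 − ρ₁)δ_false + ρ₁δ_true`,
  `q′ = (1 − ρ₂)δ_false + ρ₂δ_true` (`ρ_b ∈ [0, 1]`): the blocks are `ρ_b`-close on every set and on `S = {(false, false)}ᶜ` the product gap EQUALS `ρ₁ + ρ₂ − ρ₁ρ₂`.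
  So TV radii of independent blocks are NOT additive-and-sharp: they compose EXACTLY like g2's bad weights `W₁ + W₂ − W₁W₂`, and no constant below file 1's
  `abs_prod_real_sub_prod_real_le_of_tv` is a theorem, at any `(ρ₁, ρ₂)`.
* §2 class level, n19-c's binder prefixes VERBATIM on the product datum: `isFiniteMeasure_prodPiece` · ★ `massSandwich_prodBlocks` (blockwise MASS_cl(r_b) ⇒ MASS_cl(r₁ + r₂),
  constants add) · ★★ `tvSandwich_prodBlocks` (blockwise TV_cl(ρ_b), `ρ_b K ∈ [0, 1]` ⇒ TV_cl(ρ₁ + ρ₂ − ρ₁ρ₂)) · `shapeSandwich_prodBlocks` (per-`(K, t, τ)` measure sandwiches,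
  `tvSandwich_of_shapeSandwich`'s hypothesis shape: SHAPE_cl(r_b) ⇒ SHAPE_cl(r₁ + r₂)) · `classSandwich_prodBlocks` (one constant per `K`, NE7-S_cl letters).
* §3 ★★ `core_prodBlocks_of_mass_of_tv` — THE POINT: blockwise MASS_cl(r_b) ∧ TV_cl(ρ_b) ⇒ `Spine.NE7.Core l₀ vol T Bad P Q δ` for the MGF-form class terms of EVERY `B`-bounded
  JOINT observable on the product class space, ONE constant per `K` (the sum of the blocks' mass constants), any width
  `vol·δ_K ≥ r₁ K + r₂ K + (e^{2l₀B} − 1)·(ρ₁ K + ρ₂ K − ρ₁ K ρ₂ K)` (file 1 §2–§4 ∘ n19-c `core_of_mass_of_tv`) · ★ `tiltedMeanMatching_prodBlocks_of_tv_sharp` ∕ `_half`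
  (blockwise TV_cl ⇒ N14's binder `TiltedMeanMatching` for every bounded joint observable at g3's sharp ∕ half rate in the product radius) ·
  `core_prodBlocks_of_mass_of_shape` (blockwise MASS_cl ∧ SHAPE_cl(s_b) ⇒ the same with `ρ := 1 − e^{−2(s₁+s₂)}`-free bookkeeping: width
  `r₁ + r₂ + (e^{2l₀B} − 1)(e^{2(s₁ + s₂)} − 1)`, via `shapeSandwich_prodBlocks` ∘ n19-c `tvSandwich_of_shapeSandwich`).
READING.  g2's `core_prod` composes `Core` for PRODUCT terms with width `vol₁δ₁ + vol₂δ₂` and needs nothing class-level; for a JOINT observable the term does not factor and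
`Core` on the product needs the class-level invariant — which tensorises (file 1), at the price of the TV cross-term law `1 − (1 − ρ₁)(1 − ρ₂)` (sharp, §1) inside the
`(e^{2l₀B} − 1)`-factor.  Summability: `Σ_K (ρ₁ K + ρ₂ K) < ∞` suffices (`prodRadius ≤ ρ₁ + ρ₂`).

HONEST FRAMING.  [folklore] measure theory on hypothesis SHAPES produced by nobody; ZERO Bałaban content — [Balaban1988Convergent] (2.18)'s history weights do NOT factor over
blocks (the polymer coupling across blocks IS NE7's content); this only says what INDEPENDENTLY matched blocks would buy.  NE7 ∕ NE1′ NOT PRINTED as two-run statements for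
d = 4 and NOT proved; N14 ∕ N19 NOT discharged; K3⁷ OPEN, not claimed; counts UNMOVED (typed 28∕28 · discharged 5∕27 · A 5∕28); no count claim.  One finite four-torus
programme at fixed `ε`; R4 closes the conditional finite-𝕋⁴ rung `BalabanLadder.UV` only — NOT ℝ⁴, NOT OS, NOT the Yang–Mills mass gap, NOT Clay.  0 `def`; 0 `sorry`;
standard axioms.
-/

set_option autoImplicit false

noncomputable section

open MeasureTheory ProbabilityTheory
open scoped ENNReal

namespace Summit.QuantumFields.YangMills.BalabanUVNodes.N19CoreTVInvariantBlocks

open Summit.QuantumFields.BalabanUV.T4Continuum.NE1p.DressedMGFForm (MGFForm TiltedMeanMatching)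
open Summit.QuantumFields.BalabanUV.T4Continuum.Spine.NE7 (Core)
open Summit.QuantumFields.YangMills.BalabanUVNodes.N19TVProductBlocks
open Summit.QuantumFields.YangMills.BalabanUVNodes.N19CoreTVInvariant (core_of_mass_of_tv tvSandwich_of_shapeSandwich)
open Summit.QuantumFields.YangMills.BalabanUVNodes.N19TVTiltSharpLeaf (tiltedMeanMatching_of_tv_sharp tiltedMeanMatching_of_tv_half)
open Summit.QuantumFields.YangMills.BalabanUVNodes.N19CoreProductBlocks (mem_good_prod_iff)

/-! ## §1 Sharpness: the two-point blocks attain file 1's `1 − (1 − ρ₁)(1 − ρ₂)` [folklore] -/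

section Sharpness

/-- The two-point block: `ν = (1 − ρ)δ_false + ρδ_true` (`0 ≤ ρ ≤ 1`) is a probability law, `ρ`-close to `δ_false` on every set, with `ν{false} = 1 − ρ`. [folklore] -/
theorem twoPoint_toy {ρ : ℝ} (hρ : 0 ≤ ρ) (hρ1 : ρ ≤ 1) :
    IsProbabilityMeasure (ENNReal.ofReal (1 - ρ) • (Measure.dirac false : Measure Bool) + ENNReal.ofReal ρ • Measure.dirac true) ∧
      (∀ S : Set Bool, |(ENNReal.ofReal (1 - ρ) • (Measure.dirac false : Measure Bool) + ENNReal.ofReal ρ • Measure.dirac true).real S -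
          (Measure.dirac false : Measure Bool).real S| ≤ ρ) ∧
      (ENNReal.ofReal (1 - ρ) • (Measure.dirac false : Measure Bool) + ENNReal.ofReal ρ • Measure.dirac true) {false} =
        ENNReal.ofReal (1 - ρ) := by
  set ν : Measure Bool := ENNReal.ofReal (1 - ρ) • (Measure.dirac false : Measure Bool) + ENNReal.ofReal ρ • Measure.dirac true
    with hν
  have h1ρ : 0 ≤ 1 - ρ := sub_nonneg.2 hρ1
  have hνS : ∀ S : Set Bool, ν S = ENNReal.ofReal (1 - ρ) * S.indicator 1 false + ENNReal.ofReal ρ * S.indicator 1 true := fun S => by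
    rw [hν, Measure.add_apply, Measure.smul_apply, Measure.smul_apply, smul_eq_mul, smul_eq_mul, Measure.dirac_apply,
      Measure.dirac_apply]
  have hν₁S : ∀ S : Set Bool, (Measure.dirac false : Measure Bool) S = S.indicator 1 false := fun S => by
    rw [Measure.dirac_apply]
  have hνr : ∀ S : Set Bool, ν.real S = (1 - ρ) * (S.indicator 1 false : ℝ≥0∞).toReal + ρ * (S.indicator 1 true : ℝ≥0∞).toReal :=
    fun S => by
      rw [measureReal_def, hνS, ENNReal.toReal_add (ENNReal.mul_ne_top ENNReal.ofReal_ne_top (by by_cases h : false ∈ S <;> simp [h]))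
        (ENNReal.mul_ne_top ENNReal.ofReal_ne_top (by by_cases h : true ∈ S <;> simp [h])), ENNReal.toReal_mul, ENNReal.toReal_mul,
        ENNReal.toReal_ofReal h1ρ, ENNReal.toReal_ofReal hρ]
  have hν₁r : ∀ S : Set Bool, (Measure.dirac false : Measure Bool).real S = (S.indicator 1 false : ℝ≥0∞).toReal := fun S => by
    rw [measureReal_def, hν₁S]
  refine ⟨⟨by rw [hνS]; simp [← ENNReal.ofReal_add h1ρ hρ]⟩, fun S => ?_, by rw [hνS]; simp⟩
  rw [hνr, hν₁r]
  by_cases hf : false ∈ S <;> by_cases ht : true ∈ S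
  · simp only [Set.indicator_of_mem hf, Set.indicator_of_mem ht, Pi.one_apply, ENNReal.toReal_one]
    rw [show (1 - ρ) * 1 + ρ * 1 - 1 = 0 by ring, abs_zero]; exact hρ
  · simp only [Set.indicator_of_mem hf, Set.indicator_of_notMem ht, Pi.one_apply, ENNReal.toReal_one, ENNReal.toReal_zero]
    rw [show (1 - ρ) * 1 + ρ * 0 - 1 = -ρ by ring, abs_neg, abs_of_nonneg hρ]
  · simp only [Set.indicator_of_notMem hf, Set.indicator_of_mem ht, Pi.one_apply, ENNReal.toReal_one, ENNReal.toReal_zero]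
    rw [show (1 - ρ) * 0 + ρ * 1 - 0 = ρ by ring, abs_of_nonneg hρ]
  · simp only [Set.indicator_of_notMem hf, Set.indicator_of_notMem ht, ENNReal.toReal_zero]
    rw [show (1 - ρ) * 0 + ρ * 0 - 0 = 0 by ring, abs_zero]; exact hρ

/-- ★★ **FILE 1 §2's CONSTANT IS OPTIMAL.**  On `Bool × Bool`: run A's blocks `p = q = δ_false`, run B's `p′ = (1 − ρ₁)δ_false + ρ₁δ_true`, `q′ = (1 − ρ₂)δ_false + ρ₂δ_true`
(`ρ_b ∈ [0, 1]`).  The blocks are probability laws `ρ_b`-close on every set, and on `S = {(false, false)}ᶜ` the product gap EQUALS `ρ₁ + ρ₂ − ρ₁ρ₂` — the bound of file 1's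
`N19TVProductBlocks.abs_prod_real_sub_prod_real_le_of_tv`.  So no constant below `1 − (1 − ρ₁)(1 − ρ₂)` is a theorem, at any `(ρ₁, ρ₂)`. [folklore] -/
theorem tv_prod_sharp_toy {ρ₁ ρ₂ : ℝ} (hρ₁ : 0 ≤ ρ₁) (hρ₁1 : ρ₁ ≤ 1) (hρ₂ : 0 ≤ ρ₂) (hρ₂1 : ρ₂ ≤ 1) :
    let p : Measure Bool := Measure.dirac false
    let p' : Measure Bool := ENNReal.ofReal (1 - ρ₁) • Measure.dirac false + ENNReal.ofReal ρ₁ • Measure.dirac true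
    let q' : Measure Bool := ENNReal.ofReal (1 - ρ₂) • Measure.dirac false + ENNReal.ofReal ρ₂ • Measure.dirac true
    IsProbabilityMeasure p' ∧ IsProbabilityMeasure q' ∧
      (∀ S : Set Bool, MeasurableSet S → |p'.real S - p.real S| ≤ ρ₁) ∧ (∀ S : Set Bool, MeasurableSet S → |q'.real S - p.real S| ≤ ρ₂) ∧
      (p'.prod q').real {x | x ≠ (false, false)} - (p.prod p).real {x | x ≠ (false, false)} = ρ₁ + ρ₂ - ρ₁ * ρ₂ := by
  intro p p' q'
  obtain ⟨hP₁, hT₁, hf₁⟩ := twoPoint_toy hρ₁ hρ₁1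
  obtain ⟨hP₂, hT₂, hf₂⟩ := twoPoint_toy hρ₂ hρ₂1
  haveI := hP₁; haveI := hP₂
  refine ⟨hP₁, hP₂, fun S _ => hT₁ S, fun S _ => hT₂ S, ?_⟩
  have hS : {x : Bool × Bool | x ≠ (false, false)} = ({false} ×ˢ {false} : Set (Bool × Bool))ᶜ := by
    ext x; simp [Prod.ext_iff]
  have hSm : MeasurableSet ({false} ×ˢ {false} : Set (Bool × Bool)) := (measurableSet_singleton _).prod (measurableSet_singleton _)
  rw [hS, probReal_compl_eq_one_sub hSm, probReal_compl_eq_one_sub hSm, measureReal_def, measureReal_def, Measure.prod_prod,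
    Measure.prod_prod, hf₁, hf₂, Measure.dirac_apply, ENNReal.toReal_mul, ENNReal.toReal_ofReal (sub_nonneg.2 hρ₁1),
    ENNReal.toReal_ofReal (sub_nonneg.2 hρ₂1)]
  simp
  ring

end Sharpness


/-! ## §2 Class level: the three currencies on the product datum [folklore] -/

section Blocks

variable {ι₁ ι₂ : Type*} [DecidableEq ι₁] [DecidableEq ι₂] {Ω₁ Ω₂ : ℕ → Type*} [∀ K, MeasurableSpace (Ω₁ K)] [∀ K, MeasurableSpace (Ω₂ K)]
  {l₀ vol B : ℝ} {T₁ : ℕ → Finset ι₁} {T₂ : ℕ → Finset ι₂} {Bad₁ : ℕ → ℝ → Finset ι₁} {Bad₂ : ℕ → ℝ → Finset ι₂}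
  {μA₁ μB₁ : ∀ K, ι₁ → Measure (Ω₁ K)} {μA₂ μB₂ : ∀ K, ι₂ → Measure (Ω₂ K)} {r₁ r₂ ρ₁ ρ₂ s₁ s₂ δ : ℕ → ℝ}
  {W : ∀ K, Ω₁ K × Ω₂ K → ℝ} {P Q : ℕ → ℝ → ι₁ × ι₂ → ℝ}

omit [DecidableEq ι₁] [DecidableEq ι₂] in
/-- The product class pieces are finite on the product classes. [folklore] -/
theorem isFiniteMeasure_prodPiece (hfin₁ : ∀ K, ∀ τ ∈ T₁ K, IsFiniteMeasure (μA₁ K τ)) (hfin₂ : ∀ K, ∀ τ ∈ T₂ K, IsFiniteMeasure (μA₂ K τ)) :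
    ∀ K, ∀ τ ∈ T₁ K ×ˢ T₂ K, IsFiniteMeasure ((μA₁ K τ.1).prod (μA₂ K τ.2)) := fun K τ hτ => by
  obtain ⟨h1, h2⟩ := Finset.mem_product.1 hτ
  haveI := hfin₁ K τ.1 h1; haveI := hfin₂ K τ.2 h2
  infer_instance

/-- ★ **MASS_cl OVER BLOCKS** (n19-c's `ℝ≥0∞` letters, `core_of_mass_of_tv`'s hypothesis `hM` VERBATIM on the product datum): blockwise MASS_cl(r_b) with constants `c_b K` ⇒
MASS_cl(r₁ + r₂) for the product pieces with the constant `c₁ K + c₂ K` (file 1 `massSandwich_prod`). [folklore] -/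
theorem massSandwich_prodBlocks (hfinA₂ : ∀ K, ∀ τ ∈ T₂ K, IsFiniteMeasure (μA₂ K τ)) (hfinB₂ : ∀ K, ∀ τ ∈ T₂ K, IsFiniteMeasure (μB₂ K τ))
    (hM₁ : ∀ K : ℕ, ∃ c : ℝ, ∀ t : ℝ, |t| ≤ l₀ → ∀ τ ∈ T₁ K \ Bad₁ K t,
      ENNReal.ofReal (Real.exp (c - r₁ K)) * μA₁ K τ Set.univ ≤ μB₁ K τ Set.univ ∧
        μB₁ K τ Set.univ ≤ ENNReal.ofReal (Real.exp (c + r₁ K)) * μA₁ K τ Set.univ)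
    (hM₂ : ∀ K : ℕ, ∃ c : ℝ, ∀ t : ℝ, |t| ≤ l₀ → ∀ τ ∈ T₂ K \ Bad₂ K t,
      ENNReal.ofReal (Real.exp (c - r₂ K)) * μA₂ K τ Set.univ ≤ μB₂ K τ Set.univ ∧
        μB₂ K τ Set.univ ≤ ENNReal.ofReal (Real.exp (c + r₂ K)) * μA₂ K τ Set.univ) :
    ∀ K : ℕ, ∃ c : ℝ, ∀ t : ℝ, |t| ≤ l₀ → ∀ τ ∈ (T₁ K ×ˢ T₂ K) \ (Bad₁ K t ×ˢ T₂ K ∪ T₁ K ×ˢ Bad₂ K t),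
      ENNReal.ofReal (Real.exp (c - (r₁ K + r₂ K))) * (μA₁ K τ.1).prod (μA₂ K τ.2) Set.univ ≤ (μB₁ K τ.1).prod (μB₂ K τ.2) Set.univ ∧
        (μB₁ K τ.1).prod (μB₂ K τ.2) Set.univ ≤ ENNReal.ofReal (Real.exp (c + (r₁ K + r₂ K))) * (μA₁ K τ.1).prod (μA₂ K τ.2) Set.univ := by
  intro K
  obtain ⟨c₁, hc₁⟩ := hM₁ K
  obtain ⟨c₂, hc₂⟩ := hM₂ K
  refine ⟨c₁ + c₂, fun t ht τ hτ => ?_⟩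
  obtain ⟨hτ₁, hτ₂⟩ := mem_good_prod_iff.1 hτ
  have hτ₂T : τ.2 ∈ T₂ K := (Finset.mem_sdiff.1 hτ₂).1
  haveI := hfinA₂ K τ.2 hτ₂T; haveI := hfinB₂ K τ.2 hτ₂T
  exact massSandwich_prod (hc₁ t ht τ.1 hτ₁) (hc₂ t ht τ.2 hτ₂)

/-- ★★ **TV_cl OVER BLOCKS** (n19-c's normalised TV_cl letters, `core_of_mass_of_tv`'s hypothesis `hTV` VERBATIM on the product datum): blockwise TV_cl(ρ_b) with
`ρ_b K ∈ [0, 1]` ⇒ TV_cl(ρ₁ + ρ₂ − ρ₁ρ₂) for the product pieces (file 1 `abs_prod_div_sub_prod_div_le_of_tv`; SHARP by §1). [folklore] -/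
theorem tvSandwich_prodBlocks (hfinA₁ : ∀ K, ∀ τ ∈ T₁ K, IsFiniteMeasure (μA₁ K τ)) (hfinB₁ : ∀ K, ∀ τ ∈ T₁ K, IsFiniteMeasure (μB₁ K τ))
    (hfinA₂ : ∀ K, ∀ τ ∈ T₂ K, IsFiniteMeasure (μA₂ K τ)) (hfinB₂ : ∀ K, ∀ τ ∈ T₂ K, IsFiniteMeasure (μB₂ K τ))
    (hρ₁ : ∀ K, 0 ≤ ρ₁ K ∧ ρ₁ K ≤ 1) (hρ₂ : ∀ K, 0 ≤ ρ₂ K ∧ ρ₂ K ≤ 1)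
    (hTV₁ : ∀ (K : ℕ) (t : ℝ), |t| ≤ l₀ → ∀ τ ∈ T₁ K \ Bad₁ K t, ∀ S : Set (Ω₁ K), MeasurableSet S →
      |(μB₁ K τ).real S / (μB₁ K τ).real Set.univ - (μA₁ K τ).real S / (μA₁ K τ).real Set.univ| ≤ ρ₁ K)
    (hTV₂ : ∀ (K : ℕ) (t : ℝ), |t| ≤ l₀ → ∀ τ ∈ T₂ K \ Bad₂ K t, ∀ S : Set (Ω₂ K), MeasurableSet S →
      |(μB₂ K τ).real S / (μB₂ K τ).real Set.univ - (μA₂ K τ).real S / (μA₂ K τ).real Set.univ| ≤ ρ₂ K) :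
    ∀ (K : ℕ) (t : ℝ), |t| ≤ l₀ → ∀ τ ∈ (T₁ K ×ˢ T₂ K) \ (Bad₁ K t ×ˢ T₂ K ∪ T₁ K ×ˢ Bad₂ K t), ∀ S : Set (Ω₁ K × Ω₂ K), MeasurableSet S →
      |((μB₁ K τ.1).prod (μB₂ K τ.2)).real S / ((μB₁ K τ.1).prod (μB₂ K τ.2)).real Set.univ -
          ((μA₁ K τ.1).prod (μA₂ K τ.2)).real S / ((μA₁ K τ.1).prod (μA₂ K τ.2)).real Set.univ| ≤ ρ₁ K + ρ₂ K - ρ₁ K * ρ₂ K := by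
  intro K t ht τ hτ S hS
  obtain ⟨hτ₁, hτ₂⟩ := mem_good_prod_iff.1 hτ
  have hτ₁T : τ.1 ∈ T₁ K := (Finset.mem_sdiff.1 hτ₁).1
  have hτ₂T : τ.2 ∈ T₂ K := (Finset.mem_sdiff.1 hτ₂).1
  haveI := hfinA₁ K τ.1 hτ₁T; haveI := hfinB₁ K τ.1 hτ₁T; haveI := hfinA₂ K τ.2 hτ₂T; haveI := hfinB₂ K τ.2 hτ₂T
  exact abs_prod_div_sub_prod_div_le_of_tv (hρ₁ K).1 (hρ₁ K).2 (hρ₂ K).1 (hρ₂ K).2 (hTV₁ K t ht τ.1 hτ₁) (hTV₂ K t ht τ.2 hτ₂) hS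

/-- **SHAPE_cl OVER BLOCKS** (per-`(K, t, τ)` measure sandwiches, n19-c `tvSandwich_of_shapeSandwich`'s hypothesis shape VERBATIM on the product datum): blockwise SHAPE_cl(s_b) ⇒
SHAPE_cl(s₁ + s₂) for the product pieces (file 1 `shapeSandwich_prod`; supports multiply). [folklore] -/
theorem shapeSandwich_prodBlocks (hfinA₂ : ∀ K, ∀ τ ∈ T₂ K, IsFiniteMeasure (μA₂ K τ)) (hfinB₂ : ∀ K, ∀ τ ∈ T₂ K, IsFiniteMeasure (μB₂ K τ))
    (hSh₁ : ∀ (K : ℕ) (t : ℝ), |t| ≤ l₀ → ∀ τ ∈ T₁ K \ Bad₁ K t, ∃ c : ℝ,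
      ENNReal.ofReal (Real.exp (c - s₁ K)) • μA₁ K τ ≤ μB₁ K τ ∧ μB₁ K τ ≤ ENNReal.ofReal (Real.exp (c + s₁ K)) • μA₁ K τ)
    (hSh₂ : ∀ (K : ℕ) (t : ℝ), |t| ≤ l₀ → ∀ τ ∈ T₂ K \ Bad₂ K t, ∃ c : ℝ,
      ENNReal.ofReal (Real.exp (c - s₂ K)) • μA₂ K τ ≤ μB₂ K τ ∧ μB₂ K τ ≤ ENNReal.ofReal (Real.exp (c + s₂ K)) • μA₂ K τ) :
    ∀ (K : ℕ) (t : ℝ), |t| ≤ l₀ → ∀ τ ∈ (T₁ K ×ˢ T₂ K) \ (Bad₁ K t ×ˢ T₂ K ∪ T₁ K ×ˢ Bad₂ K t), ∃ c : ℝ,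
      ENNReal.ofReal (Real.exp (c - (s₁ K + s₂ K))) • (μA₁ K τ.1).prod (μA₂ K τ.2) ≤ (μB₁ K τ.1).prod (μB₂ K τ.2) ∧
        (μB₁ K τ.1).prod (μB₂ K τ.2) ≤ ENNReal.ofReal (Real.exp (c + (s₁ K + s₂ K))) • (μA₁ K τ.1).prod (μA₂ K τ.2) := by
  intro K t ht τ hτ
  obtain ⟨hτ₁, hτ₂⟩ := mem_good_prod_iff.1 hτ
  have hτ₂T : τ.2 ∈ T₂ K := (Finset.mem_sdiff.1 hτ₂).1
  haveI := hfinA₂ K τ.2 hτ₂T; haveI := hfinB₂ K τ.2 hτ₂T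
  obtain ⟨c₁, hc₁⟩ := hSh₁ K t ht τ.1 hτ₁
  obtain ⟨c₂, hc₂⟩ := hSh₂ K t ht τ.2 hτ₂
  exact ⟨c₁ + c₂, shapeSandwich_prod hc₁ hc₂⟩

/-- **NE7-S_cl OVER BLOCKS** (ONE constant per `K`, p496221's class-sandwich letters): blockwise class sandwiches of widths `s_b` with constants `c_b K` ⇒ the product pieces are
sandwiched with `c₁ K + c₂ K` and width `s₁ + s₂`. [folklore] -/
theorem classSandwich_prodBlocks (hfinA₂ : ∀ K, ∀ τ ∈ T₂ K, IsFiniteMeasure (μA₂ K τ)) (hfinB₂ : ∀ K, ∀ τ ∈ T₂ K, IsFiniteMeasure (μB₂ K τ))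
    (hS₁ : ∀ K : ℕ, ∃ c : ℝ, ∀ t : ℝ, |t| ≤ l₀ → ∀ τ ∈ T₁ K \ Bad₁ K t,
      ENNReal.ofReal (Real.exp (c - s₁ K)) • μA₁ K τ ≤ μB₁ K τ ∧ μB₁ K τ ≤ ENNReal.ofReal (Real.exp (c + s₁ K)) • μA₁ K τ)
    (hS₂ : ∀ K : ℕ, ∃ c : ℝ, ∀ t : ℝ, |t| ≤ l₀ → ∀ τ ∈ T₂ K \ Bad₂ K t,
      ENNReal.ofReal (Real.exp (c - s₂ K)) • μA₂ K τ ≤ μB₂ K τ ∧ μB₂ K τ ≤ ENNReal.ofReal (Real.exp (c + s₂ K)) • μA₂ K τ) :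
    ∀ K : ℕ, ∃ c : ℝ, ∀ t : ℝ, |t| ≤ l₀ → ∀ τ ∈ (T₁ K ×ˢ T₂ K) \ (Bad₁ K t ×ˢ T₂ K ∪ T₁ K ×ˢ Bad₂ K t),
      ENNReal.ofReal (Real.exp (c - (s₁ K + s₂ K))) • (μA₁ K τ.1).prod (μA₂ K τ.2) ≤ (μB₁ K τ.1).prod (μB₂ K τ.2) ∧
        (μB₁ K τ.1).prod (μB₂ K τ.2) ≤ ENNReal.ofReal (Real.exp (c + (s₁ K + s₂ K))) • (μA₁ K τ.1).prod (μA₂ K τ.2) := by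
  intro K
  obtain ⟨c₁, hc₁⟩ := hS₁ K
  obtain ⟨c₂, hc₂⟩ := hS₂ K
  refine ⟨c₁ + c₂, fun t ht τ hτ => ?_⟩
  obtain ⟨hτ₁, hτ₂⟩ := mem_good_prod_iff.1 hτ
  have hτ₂T : τ.2 ∈ T₂ K := (Finset.mem_sdiff.1 hτ₂).1
  haveI := hfinA₂ K τ.2 hτ₂T; haveI := hfinB₂ K τ.2 hτ₂T
  exact shapeSandwich_prod (hc₁ t ht τ.1 hτ₁) (hc₂ t ht τ.2 hτ₂)

/-! ## §3 The point: blockwise matching data carry every bounded JOINT observable [folklore] -/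

/-- ★★ **BLOCKWISE MASS_cl ∧ TV_cl ⇒ `Core` FOR EVERY BOUNDED JOINT OBSERVABLE ON THE PRODUCT CLASS SPACE, ONE CONSTANT.**  Two independent blocks with blockwise
MASS_cl(r_b) and TV_cl(ρ_b) (`ρ_b K ∈ [0, 1]`); a JOINT observable family `W_K : Ω₁ K × Ω₂ K → ℝ`, `|W| ≤ B`, whose dressed class terms `P`, `Q` on the product pieces are in MGF
form; then `Spine.NE7.Core l₀ vol T Bad P Q δ` on the product datum with the constant `c₁ K + c₂ K`, for any width
`vol·δ_K ≥ r₁ K + r₂ K + (e^{2l₀B} − 1)·(ρ₁ K + ρ₂ K − ρ₁ K ρ₂ K)` — §2 ∘ n19-c `core_of_mass_of_tv`.  g2's term-level `core_prod` reaches only observables whose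
terms FACTOR over the blocks; this reaches all of them, at the price of the (sharp, §1) product TV radius inside the `(e^{2l₀B} − 1)`-factor. [folklore] -/
theorem core_prodBlocks_of_mass_of_tv
    (hP : MGFForm B (fun K => T₁ K ×ˢ T₂ K) W (fun K τ => (μA₁ K τ.1).prod (μA₂ K τ.2)) P)
    (hQ : MGFForm B (fun K => T₁ K ×ˢ T₂ K) W (fun K τ => (μB₁ K τ.1).prod (μB₂ K τ.2)) Q)
    (hfinA₁ : ∀ K, ∀ τ ∈ T₁ K, IsFiniteMeasure (μA₁ K τ)) (hfinB₁ : ∀ K, ∀ τ ∈ T₁ K, IsFiniteMeasure (μB₁ K τ))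
    (hfinA₂ : ∀ K, ∀ τ ∈ T₂ K, IsFiniteMeasure (μA₂ K τ)) (hfinB₂ : ∀ K, ∀ τ ∈ T₂ K, IsFiniteMeasure (μB₂ K τ))
    (hM₁ : ∀ K : ℕ, ∃ c : ℝ, ∀ t : ℝ, |t| ≤ l₀ → ∀ τ ∈ T₁ K \ Bad₁ K t,
      ENNReal.ofReal (Real.exp (c - r₁ K)) * μA₁ K τ Set.univ ≤ μB₁ K τ Set.univ ∧
        μB₁ K τ Set.univ ≤ ENNReal.ofReal (Real.exp (c + r₁ K)) * μA₁ K τ Set.univ)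
    (hM₂ : ∀ K : ℕ, ∃ c : ℝ, ∀ t : ℝ, |t| ≤ l₀ → ∀ τ ∈ T₂ K \ Bad₂ K t,
      ENNReal.ofReal (Real.exp (c - r₂ K)) * μA₂ K τ Set.univ ≤ μB₂ K τ Set.univ ∧
        μB₂ K τ Set.univ ≤ ENNReal.ofReal (Real.exp (c + r₂ K)) * μA₂ K τ Set.univ)
    (hρ₁ : ∀ K, 0 ≤ ρ₁ K ∧ ρ₁ K ≤ 1) (hρ₂ : ∀ K, 0 ≤ ρ₂ K ∧ ρ₂ K ≤ 1)
    (hTV₁ : ∀ (K : ℕ) (t : ℝ), |t| ≤ l₀ → ∀ τ ∈ T₁ K \ Bad₁ K t, ∀ S : Set (Ω₁ K), MeasurableSet S →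
      |(μB₁ K τ).real S / (μB₁ K τ).real Set.univ - (μA₁ K τ).real S / (μA₁ K τ).real Set.univ| ≤ ρ₁ K)
    (hTV₂ : ∀ (K : ℕ) (t : ℝ), |t| ≤ l₀ → ∀ τ ∈ T₂ K \ Bad₂ K t, ∀ S : Set (Ω₂ K), MeasurableSet S →
      |(μB₂ K τ).real S / (μB₂ K τ).real Set.univ - (μA₂ K τ).real S / (μA₂ K τ).real Set.univ| ≤ ρ₂ K)
    (hw : ∀ K, r₁ K + r₂ K + (Real.exp (2 * (l₀ * B)) - 1) * (ρ₁ K + ρ₂ K - ρ₁ K * ρ₂ K) ≤ vol * δ K) :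
    Core l₀ vol (fun K => T₁ K ×ˢ T₂ K) (fun K t => Bad₁ K t ×ˢ T₂ K ∪ T₁ K ×ˢ Bad₂ K t) P Q δ :=
  core_of_mass_of_tv (Bad := fun K t => Bad₁ K t ×ˢ T₂ K ∪ T₁ K ×ˢ Bad₂ K t) (r₁ := fun K => r₁ K + r₂ K)
    (ρ := fun K => ρ₁ K + ρ₂ K - ρ₁ K * ρ₂ K) hP hQ (massSandwich_prodBlocks hfinA₂ hfinB₂ hM₁ hM₂)
    (tvSandwich_prodBlocks hfinA₁ hfinB₁ hfinA₂ hfinB₂ hρ₁ hρ₂ hTV₁ hTV₂) hw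

/-- ★ **BLOCKWISE TV_cl ⇒ N14's BINDER FOR EVERY BOUNDED JOINT OBSERVABLE, SHARP RATE**: `TiltedMeanMatching l₀ T Bad W μA W μB` on the product datum at g3's sharp rate
`2B·κg∕(1 + (κ − 1)g)`, `κ = e^{2l₀B}`, read in the product radius `g_K = ρ₁ K + ρ₂ K − ρ₁ K ρ₂ K` (§2 ∘ `…N19TVTiltSharpLeaf.tiltedMeanMatching_of_tv_sharp`). [folklore] -/
theorem tiltedMeanMatching_prodBlocks_of_tv_sharp
    (hfinA₁ : ∀ K, ∀ τ ∈ T₁ K, IsFiniteMeasure (μA₁ K τ)) (hfinB₁ : ∀ K, ∀ τ ∈ T₁ K, IsFiniteMeasure (μB₁ K τ))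
    (hfinA₂ : ∀ K, ∀ τ ∈ T₂ K, IsFiniteMeasure (μA₂ K τ)) (hfinB₂ : ∀ K, ∀ τ ∈ T₂ K, IsFiniteMeasure (μB₂ K τ))
    (hB : 0 ≤ B) (hWm : ∀ K, Measurable (W K)) (hWb : ∀ K ω, |W K ω| ≤ B)
    (hρ₁ : ∀ K, 0 ≤ ρ₁ K ∧ ρ₁ K ≤ 1) (hρ₂ : ∀ K, 0 ≤ ρ₂ K ∧ ρ₂ K ≤ 1)
    (hTV₁ : ∀ (K : ℕ) (t : ℝ), |t| ≤ l₀ → ∀ τ ∈ T₁ K \ Bad₁ K t, ∀ S : Set (Ω₁ K), MeasurableSet S →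
      |(μB₁ K τ).real S / (μB₁ K τ).real Set.univ - (μA₁ K τ).real S / (μA₁ K τ).real Set.univ| ≤ ρ₁ K)
    (hTV₂ : ∀ (K : ℕ) (t : ℝ), |t| ≤ l₀ → ∀ τ ∈ T₂ K \ Bad₂ K t, ∀ S : Set (Ω₂ K), MeasurableSet S →
      |(μB₂ K τ).real S / (μB₂ K τ).real Set.univ - (μA₂ K τ).real S / (μA₂ K τ).real Set.univ| ≤ ρ₂ K) :
    TiltedMeanMatching l₀ (fun K => T₁ K ×ˢ T₂ K) (fun K t => Bad₁ K t ×ˢ T₂ K ∪ T₁ K ×ˢ Bad₂ K t) W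
      (fun K τ => (μA₁ K τ.1).prod (μA₂ K τ.2)) W (fun K τ => (μB₁ K τ.1).prod (μB₂ K τ.2)) fun K =>
      2 * B * (Real.exp (2 * (l₀ * B)) * (ρ₁ K + ρ₂ K - ρ₁ K * ρ₂ K) / (1 + (Real.exp (2 * (l₀ * B)) - 1) * (ρ₁ K + ρ₂ K - ρ₁ K * ρ₂ K))) :=
  tiltedMeanMatching_of_tv_sharp (Bad := fun K t => Bad₁ K t ×ˢ T₂ K ∪ T₁ K ×ˢ Bad₂ K t) (ρ := fun K => ρ₁ K + ρ₂ K - ρ₁ K * ρ₂ K)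
    (isFiniteMeasure_prodPiece hfinA₁ hfinA₂) (isFiniteMeasure_prodPiece hfinB₁ hfinB₂) hB hWm hWb
    (tvSandwich_prodBlocks hfinA₁ hfinB₁ hfinA₂ hfinB₂ hρ₁ hρ₂ hTV₁ hTV₂)

/-- The same at g3's HALF rate `2B·e^{2l₀B}·(ρ₁ K + ρ₂ K − ρ₁ K ρ₂ K)` — summable as soon as `Σ (ρ₁ K + ρ₂ K) < ∞` (file 1 `prodRadius ≤ ρ₁ + ρ₂` termwise). [folklore] -/
theorem tiltedMeanMatching_prodBlocks_of_tv_half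
    (hfinA₁ : ∀ K, ∀ τ ∈ T₁ K, IsFiniteMeasure (μA₁ K τ)) (hfinB₁ : ∀ K, ∀ τ ∈ T₁ K, IsFiniteMeasure (μB₁ K τ))
    (hfinA₂ : ∀ K, ∀ τ ∈ T₂ K, IsFiniteMeasure (μA₂ K τ)) (hfinB₂ : ∀ K, ∀ τ ∈ T₂ K, IsFiniteMeasure (μB₂ K τ))
    (hB : 0 ≤ B) (hWm : ∀ K, Measurable (W K)) (hWb : ∀ K ω, |W K ω| ≤ B)
    (hρ₁ : ∀ K, 0 ≤ ρ₁ K ∧ ρ₁ K ≤ 1) (hρ₂ : ∀ K, 0 ≤ ρ₂ K ∧ ρ₂ K ≤ 1)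
    (hTV₁ : ∀ (K : ℕ) (t : ℝ), |t| ≤ l₀ → ∀ τ ∈ T₁ K \ Bad₁ K t, ∀ S : Set (Ω₁ K), MeasurableSet S →
      |(μB₁ K τ).real S / (μB₁ K τ).real Set.univ - (μA₁ K τ).real S / (μA₁ K τ).real Set.univ| ≤ ρ₁ K)
    (hTV₂ : ∀ (K : ℕ) (t : ℝ), |t| ≤ l₀ → ∀ τ ∈ T₂ K \ Bad₂ K t, ∀ S : Set (Ω₂ K), MeasurableSet S →
      |(μB₂ K τ).real S / (μB₂ K τ).real Set.univ - (μA₂ K τ).real S / (μA₂ K τ).real Set.univ| ≤ ρ₂ K) :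
    TiltedMeanMatching l₀ (fun K => T₁ K ×ˢ T₂ K) (fun K t => Bad₁ K t ×ˢ T₂ K ∪ T₁ K ×ˢ Bad₂ K t) W
      (fun K τ => (μA₁ K τ.1).prod (μA₂ K τ.2)) W (fun K τ => (μB₁ K τ.1).prod (μB₂ K τ.2)) fun K =>
      2 * B * Real.exp (2 * (l₀ * B)) * (ρ₁ K + ρ₂ K - ρ₁ K * ρ₂ K) :=
  tiltedMeanMatching_of_tv_half (Bad := fun K t => Bad₁ K t ×ˢ T₂ K ∪ T₁ K ×ˢ Bad₂ K t) (ρ := fun K => ρ₁ K + ρ₂ K - ρ₁ K * ρ₂ K)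
    (isFiniteMeasure_prodPiece hfinA₁ hfinA₂) (isFiniteMeasure_prodPiece hfinB₁ hfinB₂) hB hWm hWb
    (tvSandwich_prodBlocks hfinA₁ hfinB₁ hfinA₂ hfinB₂ hρ₁ hρ₂ hTV₁ hTV₂)

/-- **BLOCKWISE MASS_cl ∧ SHAPE_cl ⇒ `Core` FOR EVERY BOUNDED JOINT OBSERVABLE** (the SHAPE road, support-strict): blockwise MASS_cl(r_b) and per-`(K, t, τ)` measure sandwiches of
widths `s_b K ≥ 0` ⇒ `Core` on the product datum for any width `vol·δ_K ≥ r₁ K + r₂ K + (e^{2l₀B} − 1)·(e^{2(s₁ K + s₂ K)} − 1)` (`shapeSandwich_prodBlocks` ∘ n19-c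
`tvSandwich_of_shapeSandwich` ∘ `core_of_mass_of_tv`; no `[0, 1]` bookkeeping — a measure sandwich caps nothing). [folklore] -/
theorem core_prodBlocks_of_mass_of_shape
    (hP : MGFForm B (fun K => T₁ K ×ˢ T₂ K) W (fun K τ => (μA₁ K τ.1).prod (μA₂ K τ.2)) P)
    (hQ : MGFForm B (fun K => T₁ K ×ˢ T₂ K) W (fun K τ => (μB₁ K τ.1).prod (μB₂ K τ.2)) Q)
    (hfinA₁ : ∀ K, ∀ τ ∈ T₁ K, IsFiniteMeasure (μA₁ K τ)) (hfinA₂ : ∀ K, ∀ τ ∈ T₂ K, IsFiniteMeasure (μA₂ K τ))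
    (hfinB₂ : ∀ K, ∀ τ ∈ T₂ K, IsFiniteMeasure (μB₂ K τ))
    (hM₁ : ∀ K : ℕ, ∃ c : ℝ, ∀ t : ℝ, |t| ≤ l₀ → ∀ τ ∈ T₁ K \ Bad₁ K t,
      ENNReal.ofReal (Real.exp (c - r₁ K)) * μA₁ K τ Set.univ ≤ μB₁ K τ Set.univ ∧
        μB₁ K τ Set.univ ≤ ENNReal.ofReal (Real.exp (c + r₁ K)) * μA₁ K τ Set.univ)
    (hM₂ : ∀ K : ℕ, ∃ c : ℝ, ∀ t : ℝ, |t| ≤ l₀ → ∀ τ ∈ T₂ K \ Bad₂ K t,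
      ENNReal.ofReal (Real.exp (c - r₂ K)) * μA₂ K τ Set.univ ≤ μB₂ K τ Set.univ ∧
        μB₂ K τ Set.univ ≤ ENNReal.ofReal (Real.exp (c + r₂ K)) * μA₂ K τ Set.univ)
    (hs₁ : ∀ K, 0 ≤ s₁ K) (hs₂ : ∀ K, 0 ≤ s₂ K)
    (hSh₁ : ∀ (K : ℕ) (t : ℝ), |t| ≤ l₀ → ∀ τ ∈ T₁ K \ Bad₁ K t, ∃ c : ℝ,
      ENNReal.ofReal (Real.exp (c - s₁ K)) • μA₁ K τ ≤ μB₁ K τ ∧ μB₁ K τ ≤ ENNReal.ofReal (Real.exp (c + s₁ K)) • μA₁ K τ)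
    (hSh₂ : ∀ (K : ℕ) (t : ℝ), |t| ≤ l₀ → ∀ τ ∈ T₂ K \ Bad₂ K t, ∃ c : ℝ,
      ENNReal.ofReal (Real.exp (c - s₂ K)) • μA₂ K τ ≤ μB₂ K τ ∧ μB₂ K τ ≤ ENNReal.ofReal (Real.exp (c + s₂ K)) • μA₂ K τ)
    (hw : ∀ K, r₁ K + r₂ K + (Real.exp (2 * (l₀ * B)) - 1) * (Real.exp (2 * (s₁ K + s₂ K)) - 1) ≤ vol * δ K) :
    Core l₀ vol (fun K => T₁ K ×ˢ T₂ K) (fun K t => Bad₁ K t ×ˢ T₂ K ∪ T₁ K ×ˢ Bad₂ K t) P Q δ :=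
  core_of_mass_of_tv (Bad := fun K t => Bad₁ K t ×ˢ T₂ K ∪ T₁ K ×ˢ Bad₂ K t) (r₁ := fun K => r₁ K + r₂ K)
    (ρ := fun K => Real.exp (2 * (s₁ K + s₂ K)) - 1) hP hQ (massSandwich_prodBlocks hfinA₂ hfinB₂ hM₁ hM₂)
    (tvSandwich_of_shapeSandwich (r₂ := fun K => s₁ K + s₂ K) (isFiniteMeasure_prodPiece hfinA₁ hfinA₂) (fun K => add_nonneg (hs₁ K) (hs₂ K))
      (shapeSandwich_prodBlocks hfinA₂ hfinB₂ hSh₁ hSh₂)) hw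

end Blocks

end Summit.QuantumFields.YangMills.BalabanUVNodes.N19CoreTVInvariantBlocks

end
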